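import Literature.NumberTheory.EllipticCurves.AnticyclotomicSignedHeegnerClasses
import Summits.BirchSwinnertonDyer.BirchSwinnertonDyer.Theorems.SignedBaseChangeAnticyclotomicEisensteinDivisibilityAdmdefUnitLambdaOfLoc
import HarnessLib

/-!
# Line `admdef`: the BOTTOM LAYER of the `+` signed Heegner class is the Kummer class of the Heegner norm point
# `z_0 = N_{K[p]/K}(x_p)`, and Howard's criterion [NV] at the ROOT of the bipartite system — kernel
# (crux `AnticyclotomicEisensteinDivisibility`, stmt-BirchSwinnertonDyer-20727; LEAD seat bsd-line-sbc-p1 gen 19,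
# `--supports stmt-BirchSwinnertonDyer-20727`)

WHY THIS FILE.  Sequel of `Theorems/…AdmdefUnitLambdaOfLoc.lean` (p744566), which reads Howard's criterion
`B.HasUnitLambda N` (CHKLL25 Thm. 7.5) at the bottom layer through the typed second reciprocity law: [NV] holds as
soon as the bottom component `z_{0,1} ∈ H¹(K, E[p])` of the limit base class `z` of the system has a non-zero
restriction to `⟨φ⟩` for a Frobenius `φ` at a prime over a `1`-admissible `q`.  The typed CHKLL25 Thm. 7.4
(`thm74_exists_signedBipartiteSystem`) delivers its system TOGETHER with a limit base class which IS the `ε`-signed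
Heegner class of a trace-coherent Heegner family `F` (`AcSigned.IsSignedHeegnerClass p κ γ F ε z`, Castella–Wan
Prop. 4.4 / Def. 4.5 as pinned by the tree).  THIS FILE identifies, in kernel, what that pinning says at the bottom
layer `n = 0` for the sign `+` (`ε = 1`, the sign of the route): the multiplier `ω̃⁻_0` is the EMPTY product `1`,
the layer-`0` Galois group is all of `Γ_K` (`κ.layerSubgroup 0 = ⊤`) so `γ − 1` acts as `0` on `H¹(K_0, E[p^m])`
(inner automorphisms act trivially on cohomology), and the truncated `Λ`-action of ANY `f ∈ ℤ_p⟦T⟧` at layer `0`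
is multiplication by `f(0) mod p^m` (`tsmul_layer_zero`); hence

* `layer_zero_eq_kummerClass_of_isSignedHeegnerClass_one` — **`z_{0,m} = δ_K(z_0)`**, the Kummer class over `K` of
  the norm point `z_0 = F.z 0 = N_{K[p]/K} P[p]` (for `m ≥ 1`; printed: Prop. 4.4 at `n = 0`, `S = 1`:
  `ω̃⁻_0 · z_0[1]^+ = Cor_0(z[p])`), and
* `hasUnitLambda_of_heegnerRoot_res_ne_zero` — **[NV] at the ROOT**: for a `+` system `B` (`IsSignedBipartiteSystem … N 1 B`)
  whose limit base class is the `+` signed Heegner class of `F` (the output shape of the typed Thm. 7.4), if the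
  Kummer class `δ_K(z_0) ∈ H¹(K, E[p])` restricts NON-trivially to `⟨φ⟩` for a Frobenius `φ ∈ D_𝔓 ∩ Gal(K̄/K_∞)` at a
  prime `𝔓` over a `1`-admissible `q`, then `λ⁺_1(q)(0) ∈ ℤ_pˣ` and `B.HasUnitLambda N`.

With `a_p = 0` the norm relation gives `z_0 = (a_p − σ_𝔭 − σ_𝔭̄)·y_K = −2·y_K` up to the unit index `u_K = 1`
(Perrin-Riou / Castella–Wan Prop. 4.1; NOT used or proved here), so the hypothesis is «the basic Heegner point is
not divisible by `p` in `E(K_𝔮)` at some admissible `𝔮`», i.e. (Čebotarev) «`δ(y_K) ≢ 0 mod p`» — Howard's primitive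
case, in which Kolyvagin's original descent already yields the `p`-part of BSD in rank one.  HONEST FRAMING: a kernel
reading of typed predicates (CHKLL25 Thm. 7.4's laws, Castella–Wan's pinning); no named fact is consumed or asserted;
[NV], the BRIDGE, (Anch±) and the crux are NOT proved (the CONTRAPOSITIVE locates the line's research residue: an
anchor at a deeper definite vertex is needed exactly when `δ_K(z_0)` dies at every admissible Frobenius).  BSD is not
proved by this file.

References: [cite: CastellaWan2023, Prop. 4.4, Def. 4.5 and §4.2 p. 22 (MS pp. 20–22); Prop. 4.1 and (4.1) (MS p. 18)]
[cite: CastellaEtAl2025, Thm. 7.4 (second law), (7.2), Thm. 7.5 (arXiv:2308.10474v2 p0030 L29–L62, p0031 L1–L30)]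
[cite: Howard2006, Thm. 3.2.3 (c), §3.2 (16)] [cite: SerreLocalFields1979, VII.§5 Prop. 3] [cite: GrossKolyvagin1991, §2 (Kummer classes of Heegner points)].
-/

-- D-0017: single-problem summit, the namespace repeats the problem name by design.
set_option linter.dupNamespace false
set_option autoImplicit false

noncomputable section

open scoped Classical
open NumberField IsDedekindDomain Field
open Literature.NumberTheory.EllipticCurves Literature.NumberTheory.GaloisRepresentations
open Literature.NumberTheory.EllipticCurves.IwasawaDual Literature.NumberTheory.EllipticCurves.AcSigned
open Literature.NumberTheory.EllipticCurves.BertoliniDarmon2005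
open Literature.NumberTheory.EllipticCurves.CastellaHsuKunduLeeLiu2025
open WeierstrassCurve (geomTorsion geomPoints)
open Summit.BirchSwinnertonDyer.BirchSwinnertonDyer.Theorems.SignedBaseChangeAcDivAdmdefUnitLambdaOfLoc

namespace Summit.BirchSwinnertonDyer.BirchSwinnertonDyer.Theorems.SignedBaseChangeAcDivAdmdefUnitLambdaOfHeegnerRoot

universe u

/-! ## §1 The truncated `Λ`-action on global families at the bottom layer -/

section LayerZero

variable {K : Type u} [Field K] (W : WeierstrassCurve K) (p : ℕ) [Fact p.Prime]
  (κ : ZpExtension K p) (γ : absoluteGaloisGroup K)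

/-- At layer `0` the operator `ψ_{0,m} = conj_γ − 1` of Castella–Wan's `Λ`-action acts as ZERO: `K_0 = K`
(`κ.layerSubgroup 0 = ⊤`), so `γ` lies in the layer group and inner automorphisms act trivially on `H¹`
(`conjH1_of_mem_holds`). [cite: SerreLocalFields1979, VII.§5 Prop. 3] [cite: CastellaWan2023, §4.1 (MS p. 19, `Y = γ^ac − 1`)] -/
theorem psi_layer_zero_apply (m : ℕ) (y : W.torsionH1Over ((p : ℤ) ^ m) (κ.layerSubgroup 0)) :
    psi W p κ γ 0 m y = 0 := by
  have hγ : γ ∈ κ.layerSubgroup 0 := by rw [ZpExtension.layerSubgroup_zero]; trivial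
  rw [psi_apply, conjH1_of_mem_holds (κ.layerSubgroup 0) (geomTorsion W ((p : ℤ) ^ m)) hγ, AddMonoidHom.id_apply,
    sub_self]

/-- Hence every positive power of `ψ_{0,m}` acts as zero at layer `0`. [cite: SerreLocalFields1979, VII.§5 Prop. 3] -/
theorem psi_layer_zero_pow_apply {i : ℕ} (hi : i ≠ 0) (m : ℕ) (y : W.torsionH1Over ((p : ℤ) ^ m) (κ.layerSubgroup 0)) :
    (psi W p κ γ 0 m ^ i) y = 0 := by
  obtain ⟨k, rfl⟩ := Nat.exists_eq_succ_of_ne_zero hi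
  rw [AddMonoid.End.coe_pow, Function.iterate_succ_apply, psi_layer_zero_apply,
    Function.iterate_fixed (map_zero (psi W p κ γ 0 m)) k]

/-- **At the bottom layer the truncated `Λ`-action on `H¹(K, E[p^m])` is multiplication by the constant coefficient through
`ℤ_p → ℤ/p^m`**: `(f · x)_{0,m} = (f(0) mod p^m) · x_{0,m}`. [cite: CastellaWan2023, §4.1 (MS p. 19)] [cite: Lang1990, Ch. 5 §1 Thm. 1.1] -/
theorem tsmul_layer_zero (f : IwasawaAlgebra p) (x : Π n m : ℕ, W.torsionH1Over ((p : ℤ) ^ m) (κ.layerSubgroup n))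
    (m : ℕ) : tsmul W p κ γ f x 0 m = (PadicInt.toZModPow m (PowerSeries.constantCoeff f)).val • x 0 m := by
  rcases Nat.eq_zero_or_pos m with rfl | hm
  · haveI : Subsingleton (ZMod (p ^ 0)) := ZMod.subsingleton_iff.2 (pow_zero p)
    rw [Subsingleton.elim (PadicInt.toZModPow 0 (PowerSeries.constantCoeff f)) 0, ZMod.val_zero, zero_smul, tsmul,
      evalT_def, zero_mul, Finset.sum_range_zero]
  · rw [tsmul, evalT_def]
    have h0 : 0 ∈ Finset.range (m * p ^ 0) := Finset.mem_range.mpr (by rw [pow_zero, mul_one]; exact hm)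
    rw [Finset.sum_eq_single_of_mem 0 h0 fun i _ hi ↦ by
      rw [AddMonoidHom.id_apply, psi_layer_zero_pow_apply W p κ γ hi, zpT_zero_right]]
    rw [pow_zero (psi W p κ γ 0 m), AddMonoid.End.one_apply, AddMonoidHom.id_apply, zpT_def,
      PowerSeries.coeff_zero_eq_constantCoeff_apply]

end LayerZero

/-! ## §2 The bottom layer of the `+` signed Heegner class -/

section Heegner

variable {K : Type u} [Field K] [NumberField K] {N : ℕ} [NeZero N] {W : WeierstrassCurve ℚ} {p : ℕ} [Fact p.Prime]
  {κ : ZpExtension K p} {γ : absoluteGaloisGroup K} {jbar : AlgebraicClosure K →+* ℂ}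

/-- The `+` multiplier at layer `0` is the empty product: `ω̃⁻_0 = 1` in `ℤ_p⟦T⟧`. [cite: CastellaWan2023, (3.5) and Prop. 4.4 (MS pp. 11, 20)] -/
theorem omegaTildeOpp_one_zero : omegaTildeOpp p 1 0 = 1 := by
  rw [omegaTildeOpp_one, cyclotomicOmegaMinus_zero, Polynomial.map_one, Polynomial.coe_one]

/-- **The bottom layer of the `+` signed Heegner class is the Kummer class of the norm point `z_0 = F.z 0 =
N_{K[p]/K_0} P[p]`** (`K_0 = K`): if `z` IS the `+`-signed `Λ^ac`-adic Heegner class of the family `F`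
(`IsSignedHeegnerClass p κ γ F 1 z`: at every EVEN layer `n`, `ω̃⁻_n(γ−1)·z_{n,m} = (−1)^{⌊(n+1)/2⌋} δ_{K_n}(z_n)`), then at
`n = 0` (`ω̃⁻_0 = 1`, `(−1)^0 = 1`, and the `Λ`-action at layer `0` is the constant coefficient) `z_{0,m} = δ_K(z_0)` for every
`m ≥ 1` and every `p^m`-th root `Q` of `z_0`.  Printed: Prop. 4.4 with `n = 0`, `S = 1` («`ω̃^{-ε}_n(Y) z_n[S]^ε = Cor_n(z[Sp^{n+1}])`»).
[cite: CastellaWan2023, Prop. 4.4, Def. 4.5 and §4.2 p. 22 (MS pp. 20–22)] -/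
theorem layer_zero_eq_kummerClass_of_isSignedHeegnerClass_one {F : HeegnerFamily N W K κ jbar}
    {z : Π n m : ℕ, (W.baseChange K).torsionH1Over ((p : ℤ) ^ m) (κ.layerSubgroup n)}
    (hz : IsSignedHeegnerClass p κ γ F 1 z) {m : ℕ} (hm : 0 < m) (Q : geomPoints (W.baseChange K))
    (hQ : ((p : ℤ) ^ m) • Q = F.z 0) :
    z 0 m = (W.baseChange K).kummerClassOver (κ.layerSubgroup 0) ((p : ℤ) ^ m) Q
      (fun σ hσ ↦ by rw [hQ]; exact (F.isHeegnerNormPoint_z 0).smul_eq_self hσ) := by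
  have h := hz 0 (pow_zero _) m Q hQ
  have hval : (PadicInt.toZModPow m (1 : ℤ_[p])).val = 1 := by
    rw [map_one, ZMod.val_one_eq_one_mod]
    exact Nat.one_mod_eq_one.mpr (Nat.one_lt_pow hm.ne' (Fact.out : p.Prime).one_lt).ne'
  rw [omegaTildeOpp_one_zero, tsmul_layer_zero, map_one, hval, one_smul] at h
  rw [h]
  norm_num

end Heegner

/-! ## §3 Howard's criterion at the root of a `+` system pinned to a Heegner family -/

section Root

variable {K : Type} [Field K] [NumberField K] {N : ℕ} [NeZero N] {W : WeierstrassCurve ℚ} [W.IsGloballyMinimal]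
  {p : ℕ} [Fact p.Prime] {κ : ZpExtension K p} {γ : absoluteGaloisGroup K} {jbar : AlgebraicClosure K →+* ℂ}
  {B : SignedBipartiteSystem W K p κ}

/-- **[NV] at the ROOT of a `+` signed bipartite system pinned to a Heegner family** (the output shape of the typed CHKLL25
Thm. 7.4, `thm74_exists_signedBipartiteSystem`: `IsSignedBipartiteSystem … N 1 B`, limit base class `z` with
`IsSignedHeegnerClass p κ γ F 1 z`): if the Kummer class `δ_K(z_0) ∈ H¹(K, E[p])` of the Heegner norm point `z_0 = F.z 0`
has NON-ZERO restriction to `⟨φ⟩` for a Frobenius `φ ∈ D_𝔓 ∩ Gal(K̄/K_∞)` at a prime `𝔓` over a `1`-admissible `q`, then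
`λ⁺_1(q)(0) ∈ ℤ_pˣ` and Howard's criterion `B.HasUnitLambda N` holds — by `layer_zero_eq_kummerClass_of_isSignedHeegnerClass_one`
and the second reciprocity law at the bottom layer (`…AdmdefUnitLambdaOfLoc.hasUnitLambda_of_limitBaseClass_res_ne_zero`).
Primitive-root case of Thm. 7.5's equality; the contrapositive is the line's reason for a deeper anchor.
[cite: CastellaEtAl2025, Thm. 7.4 second law, (7.2), Thm. 7.5 (arXiv:2308.10474v2 p0030 L50–L62, p0031 L1–L30)]
[cite: CastellaWan2023, Prop. 4.4, Def. 4.5 (MS pp. 20–22)] [cite: Howard2006, Thm. 3.2.3 (c), §3.2 (16)] -/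
theorem hasUnitLambda_of_heegnerRoot_res_ne_zero (hB : IsSignedBipartiteSystem W K p κ γ N 1 B)
    {F : HeegnerFamily N W K κ jbar}
    {z : Π n m : ℕ, (W.baseChange K).torsionH1Over ((p : ℤ) ^ m) (κ.layerSubgroup n)} (hzB : B.IsLimitBaseClass z)
    (hzF : IsSignedHeegnerClass p κ γ F 1 z) {q : ℕ} (hq : IsAdmissiblePrime N K (fun ℓ ↦ W.frobeniusTrace ℓ) p 1 q)
    {v : HeightOneSpectrum (𝓞 K)} (hv : ((q : ℕ) : 𝓞 K) ∈ v.asIdeal) {𝔓 : Ideal (absIntegers (𝓞 K) K)}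
    (h𝔓 : 𝔓 ∈ v.primesAbove) {φ : absoluteGaloisGroup K} (hφ : φ ∈ κ.kerSubgroup)
    (hφD : φ ∈ 𝔓.decompositionSubgroup (absoluteGaloisGroup K)) (hφF : IsArithFrobAt (𝓞 K) φ 𝔓)
    (Q : geomPoints (W.baseChange K)) (hQ : ((p : ℤ) ^ 1) • Q = F.z 0)
    (hne : resOfLe (geomTorsion (W.baseChange K) ((p : ℤ) ^ 1))
      ((Subgroup.zpowers_le.mpr hφ).trans (κ.kerSubgroup_le_layerSubgroup 0))
      ((W.baseChange K).kummerClassOver (κ.layerSubgroup 0) ((p : ℤ) ^ 1) Q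
        (fun σ hσ ↦ by rw [hQ]; exact (F.isHeegnerNormPoint_z 0).smul_eq_self hσ)) ≠ 0) :
    IsUnit (PowerSeries.constantCoeff (B.lam 1 q)) ∧ B.HasUnitLambda N := by
  rw [← layer_zero_eq_kummerClass_of_isSignedHeegnerClass_one hzF one_pos Q hQ] at hne
  exact hasUnitLambda_of_limitBaseClass_res_ne_zero hB hzB hq hv h𝔓 hφ hφD hφF hne

end Root

end Summit.BirchSwinnertonDyer.BirchSwinnertonDyer.Theorems.SignedBaseChangeAcDivAdmdefUnitLambdaOfHeegnerRoot

end
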